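import Summits.BirchSwinnertonDyer.BirchSwinnertonDyer.Theorems.GoldfeldAllTwistsTwoConverseTwinGenusDescentIndex
import Summits.BirchSwinnertonDyer.BirchSwinnertonDyer.Theorems.GoldfeldAllTwistsTwoConverseTwinGenusOddMultiple
import Summits.BirchSwinnertonDyer.Uniform.U2.CharHeegnerHeightPositivity
import Literature.NumberTheory.EllipticCurves.HeegnerPointsOfConductorOneData
import Literature.NumberTheory.EllipticCurves.HeightsBaseChangeProofs
import Literature.NumberTheory.EllipticCurves.BSDInvariantsRegulatorProofs
import Literature.NumberTheory.EllipticCurves.VariableChangePoints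
import HarnessLib

set_option linter.dupNamespace false
set_option autoImplicit false

/-!
# LINE B49, genus assembly (A), step W-A6 part I: the HEIGHT TRANSPORT of the constant chain (row C7) —
# `ĥ_F((0, i)) = [F : ℚ] · ĥ_ℚ(g₇₈₄)` for the point `(0, i)` of `X₀(49)` over any number field `F ∋ i`
# and the generator `g₇₈₄ = (8, 8)` of `W₇₈₄ = [0, −21, 0, 112, 0]`; and the reindexing `𝒢₁ = d.S`

Cell `bsd-goldfeld`, seat `bsd-goldfeld-s1p-c3` (prover, gen 8); memo `HOME/GENUS-THEOREM-A.md` §3 row C7,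
planner g19 rulings (xlviii)/(xlix) (W-A6). Support for item `stmt-BirchSwinnertonDyer-19140` (crux twin″; joint
with 20044 K12₂″). Theses-free; theorems only. HONEST FRAMING: elementary bookkeeping about explicit
Weierstrass models and Néron–Tate heights; nothing about `L`-values, Theorem A or BSD is asserted here.

CONTENTS.
* §1 `canonicalHeight_some_congr`: the canonical height of an affine point `(x, y)` does not depend on which
  of two EQUAL Weierstrass equations it is read on (transport along `W₁ = W₂`).
* §2 The explicit isomorphism over a field `F ∋ i` (`i² = −1`):
  `(−i/2, 2, −1/2, −1) • (cm7 ⊗ F) = W₇₈₄ ⊗ F` (`smul_cm7_baseChange_eq_W784`), under which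
  `(0, i) ↦ (8, 8) = g₇₈₄` (`pointEquiv_zeroI_cm7`): `x' = u⁻²(x − 2) = −4·(−2)`, `y' = u⁻³·i = 8`.
* §3 **Row C7**: for a number field `F` and `(0, i) ∈ X₀(49)(F)`,
  `ĥ_F((0, i)) = [F : ℚ] · ĥ_ℚ(g₇₈₄)` (`canonicalHeight_zeroI_cm7_eq`) — `ĥ` is invariant under changes of
  variables (Silverman VIII.9.1, tree `canonicalHeight_pointEquiv`) and multiplies by the degree under base
  change (tree `canonicalHeight_baseChange`). In particular `ĥ_F((0, i)) ≠ 0` (`g₇₈₄` has infinite order,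
  seat c301's `not_isOfFinAddOrder_eightEight_W784`).
* §4 `sum_S_eq_sum_ringClassGal`: at conductor `1` a sum over the transversal `d.S` of a Kolyvagin–Heegner
  datum is the sum over the subgroup `𝒢₁ = ringClassGal ι 1` (`KolyvaginHeegnerData.mem_S_iff`), the index
  set of Cai–Shu–Tian's `χ`-Heegner vector; and the sign function of the genus character as a `ℤˣ`-valued
  function (`exists_units_sign`).

References: J. H. Silverman, AEC (2009) III.1 Table 3.1, Prop. VIII.9.1, Prop. VIII.5.4(b)
[SilvermanAEC2009]; B. Gross, in *L-functions and Arithmetic* (1991) §4 [GrossLMS1991].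
-/

noncomputable section

open scoped Classical

open WeierstrassCurve Literature.NumberTheory.EllipticCurves
  Literature.NumberTheory.EllipticCurves.ModularForms

namespace Summit.BirchSwinnertonDyer.BirchSwinnertonDyer.Theorems.GoldfeldGoodTwists

-- NOTE on decidability worlds: every statement below is about `canonicalHeight` of an EXPLICIT affine point
-- (`Affine.Point.some …`) or is generic in its instances, so it can be consumed verbatim both in the
-- classical-at-top-priority world of `…TwinGenusTheoremAReduction` (hypothesis `hHR`) and in the default one.

/-! ## §1 Transport of the canonical height along an equality of equations -/

section Congr

variable {F : Type*} [Field F] [Height.AdmissibleAbsValues F]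

/-- The canonical height of the affine point `(x, y)` read on two EQUAL Weierstrass equations is the
same number. [cite: SilvermanAEC2009, Prop. VIII.9.1] -/
theorem canonicalHeight_some_congr {W₁ W₂ : WeierstrassCurve F} (h : W₁ = W₂) {x y : F}
    (h₁ : W₁.toAffine.Nonsingular x y) (h₂ : W₂.toAffine.Nonsingular x y) :
    Affine.Point.canonicalHeight (Affine.Point.some x y h₁) =
      Affine.Point.canonicalHeight (Affine.Point.some x y h₂) := by
  subst h
  rfl

end Congr

/-! ## §2 The explicit isomorphism `X₀(49) ≅ W₇₈₄` over a field containing `i` -/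

section Iso

variable {F : Type*} [Field F] [CharZero F] {i : F}

/-- `i ≠ 0` and `−i/2 ≠ 0` when `i² = −1`. [folklore] -/
theorem neg_div_two_ne_zero_of_sq (hi : i ^ 2 = -1) : -i / 2 ≠ 0 := by
  have hi0 : i ≠ 0 := by
    rintro rfl
    norm_num at hi
  exact div_ne_zero (neg_ne_zero.mpr hi0) two_ne_zero

/-- **`(−i/2, 2, −1/2, −1) • (X₀(49) ⊗ F) = W₇₈₄ ⊗ F`** for `i² = −1`: the substitution
`x = u²x' + 2`, `y = u³y' − u²x'/2 − 1` with `u = −i/2` (`u² = −1/4`, `u⁴ = 1/16`, `u⁶ = −1/64`) takes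
`y² + xy = x³ − x² − 2x − 1` to `y'² = x'³ − 21x'² + 112x'`. [cite: SilvermanAEC2009, III.1 Table 3.1] -/
theorem smul_cm7_baseChange_eq_W784 (hi : i ^ 2 = -1) :
    (⟨Units.mk0 (-i / 2) (neg_div_two_ne_zero_of_sq hi), 2, -1 / 2, -1⟩ : VariableChange F) •
        cm7.baseChange F =
      (⟨0, -21, 0, 112, 0⟩ : WeierstrassCurve ℚ).baseChange F := by
  have hi3 : i ^ 3 = -i := by linear_combination i * hi
  have hi4 : i ^ 4 = 1 := by linear_combination (i ^ 2 - 1) * hi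
  have hi6 : i ^ 6 = -1 := by linear_combination (i ^ 4 - i ^ 2 + 1) * hi
  have hi0 : i ≠ 0 := by rintro rfl; norm_num at hi
  ext
  · simp [baseChange, variableChange_a₁]
    norm_num
  · simp [baseChange, variableChange_a₂]
    field_simp
    linear_combination (21 : F) * hi
  · simp [baseChange, variableChange_a₃]
  · simp [baseChange, variableChange_a₄]
    field_simp
    linear_combination (-(112 : F)) * hi4
  · simp [baseChange, variableChange_a₆]
    norm_num

/-- `g₇₈₄ = (8, 8)` lies on `W₇₈₄ ⊗ F`. [folklore] -/
theorem nonsingular_W784_baseChange_eight_eight (F : Type*) [Field F] [CharZero F] :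
    ((⟨0, -21, 0, 112, 0⟩ : WeierstrassCurve ℚ).baseChange F).toAffine.Nonsingular 8 8 := by
  haveI := isElliptic_twoTorsionModel_neg_one
  haveI : ((⟨0, -21, 0, 112, 0⟩ : WeierstrassCurve ℚ).baseChange F).IsElliptic := by
    rw [WeierstrassCurve.baseChange]; infer_instance
  refine (Affine.equation_iff_nonsingular).mp ?_
  rw [Affine.equation_iff']
  simp [baseChange]
  norm_num

/-- **`(0, i) ↦ (8, 8)`** under the substitution of `smul_cm7_baseChange_eq_W784`:
`x' = u⁻²(0 − 2) = (−4)(−2) = 8`, `y' = u⁻³(i − (−1/2)(0 − 2) − (−1)) = u⁻³·i = (−8i)·i = 8`.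
[cite: SilvermanAEC2009, III.1 Table 3.1] -/
theorem pointEquiv_zeroI_cm7 (hi : i ^ 2 = -1) (hg : (cm7.baseChange F).toAffine.Nonsingular 0 i) :
    VariableChange.pointEquiv (cm7.baseChange F)
        (⟨Units.mk0 (-i / 2) (neg_div_two_ne_zero_of_sq hi), 2, -1 / 2, -1⟩ : VariableChange F)
        (Affine.Point.some 0 i hg) =
      Affine.Point.some 8 8 ((smul_cm7_baseChange_eq_W784 hi).symm ▸
        nonsingular_W784_baseChange_eight_eight F) := by
  have hi0 : i ≠ 0 := by rintro rfl; norm_num at hi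
  have hi3 : i ^ 3 = -i := by linear_combination i * hi
  rw [VariableChange.pointEquiv_some]
  congr 1
  · simp only [VariableChange.toX_def, Units.val_inv_eq_inv_val, Units.val_mk0, inv_pow]
    field_simp
    linear_combination (-(8 : F)) * hi
  · simp only [VariableChange.toY_def, Units.val_inv_eq_inv_val, Units.val_mk0, inv_pow]
    field_simp
    linear_combination (-(8 : F)) * hi3

end Iso

/-! ## §3 Row C7: `ĥ_F((0, i)) = [F : ℚ] · ĥ_ℚ(g₇₈₄)` -/

section Height

variable {F : Type*} [Field F] [NumberField F] {i : F}

/-- **Row C7 of the constant chain.** For a number field `F`, every point `(0, i) ∈ X₀(49)(F)` (so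
`i² = −1`) has canonical height `ĥ_F((0, i)) = [F : ℚ] · ĥ_ℚ(g₇₈₄)`, `g₇₈₄ = (8, 8) ∈ W₇₈₄(ℚ)`,
`W₇₈₄ = [0, −21, 0, 112, 0]` (heights RELATIVE to the field, tree `canonicalHeight`): `(0, i)` is the image
of `g₇₈₄` under an `F`-isomorphism `W₇₈₄ ⊗ F ≅ X₀(49) ⊗ F` (§2; `ĥ` is invariant, Silverman VIII.9.1 — tree
`canonicalHeight_pointEquiv`), and `ĥ_F = [F : ℚ]·ĥ_ℚ` on `ℚ`-points (VIII.5.4(b) — tree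
`canonicalHeight_baseChange`). [cite: SilvermanAEC2009, Prop. VIII.9.1 and Prop. VIII.5.4(b)] -/
theorem canonicalHeight_zeroI_cm7_eq (hg : (cm7.baseChange F).toAffine.Nonsingular 0 i) :
    Affine.Point.canonicalHeight (Affine.Point.some 0 i hg) =
      (Module.finrank ℚ F : ℝ) *
        Affine.Point.canonicalHeight (Affine.Point.some 8 8 nonsingular_W784_eight_eight :
          (⟨0, -21, 0, 112, 0⟩ : WeierstrassCurve ℚ).toAffine.Point) := by
  haveI := isElliptic_twoTorsionModel_neg_one
  have hi : i ^ 2 = -1 := sq_eq_neg_one_of_nonsingular_zero hg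
  -- invariance under the change of variables, read on `W₇₈₄ ⊗ F`
  have h1 := Affine.Point.canonicalHeight_pointEquiv (W := cm7.baseChange F)
    (⟨Units.mk0 (-i / 2) (neg_div_two_ne_zero_of_sq hi), 2, -1 / 2, -1⟩ : VariableChange F)
    (Affine.Point.some 0 i hg)
  rw [pointEquiv_zeroI_cm7 hi hg, canonicalHeight_some_congr (smul_cm7_baseChange_eq_W784 hi) _
    (nonsingular_W784_baseChange_eight_eight F)] at h1
  rw [← h1]
  -- base change from `ℚ` to `F`
  have h2 := Affine.Point.canonicalHeight_baseChange (R := ℚ) (K := ℚ) (L := F)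
    (W := (⟨0, -21, 0, 112, 0⟩ : WeierstrassCurve ℚ))
    (Affine.Point.some 8 8 nonsingular_W784_eight_eight)
  have h3 : Affine.Point.baseChange (W' := (⟨0, -21, 0, 112, 0⟩ : WeierstrassCurve ℚ)) ℚ F
        (Affine.Point.some 8 8 nonsingular_W784_eight_eight) =
      Affine.Point.some 8 8 (nonsingular_W784_baseChange_eight_eight F) := by
    show Affine.Point.map (Algebra.ofId ℚ F) _ = _
    rw [Affine.Point.map_some]
    congr 1 <;> simp
  convert h2 using 2
  · exact h3.symm
  · rfl

/-- Hence `ĥ_F((0, i)) ≠ 0`: `g₇₈₄` has infinite order (seat c301, `not_isOfFinAddOrder_eightEight_W784`)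
and `ĥ = 0` exactly on torsion (Silverman VIII.9.3(d), tree `canonicalHeight_eq_zero_iff_holds`).
[cite: SilvermanAEC2009, Thm. VIII.9.3(d)] -/
theorem canonicalHeight_zeroI_cm7_ne_zero (hg : (cm7.baseChange F).toAffine.Nonsingular 0 i) :
    Affine.Point.canonicalHeight (Affine.Point.some 0 i hg) ≠ 0 := by
  haveI := isElliptic_twoTorsionModel_neg_one
  rw [canonicalHeight_zeroI_cm7_eq hg]
  refine mul_ne_zero (by exact_mod_cast Module.finrank_pos.ne') fun h0 ↦ ?_
  exact not_isOfFinAddOrder_eightEight_W784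
    ((Summit.BirchSwinnertonDyer.Uniform.U2.HeegnerHeight.canonicalHeight_eq_zero_iff' _).mp h0)

end Height

/-! ## §4 Conductor `1`: sums over `d.S` are sums over `𝒢₁`; the sign function of the genus character -/

section Reindex

variable {N : ℕ} [NeZero N] {W : WeierstrassCurve ℚ} {K : Type} [Field K] [NumberField K]
  {ι : K →+* ℂ}

/-- **`Σ_{s ∈ d.S} f(s) = Σ_{σ ∈ 𝒢₁} f(σ)`** at conductor `1`: the transversal `d.S` of a conductor-one
Kolyvagin–Heegner datum is exactly the subgroup `𝒢₁ = Gal(K[1]/K)` (`KolyvaginHeegnerData.mem_S_iff`),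
so a sum over the finset `d.S` is the sum over the subtype `ringClassGal ι 1` — the index set of
Cai–Shu–Tian's `χ`-Heegner vector `P⁰_χ(f) = Σ_σ χ(σ)·σy`. [cite: GrossLMS1991, §4 (S at n = 1, P_1 = Tr y_1)] -/
theorem sum_S_eq_sum_ringClassGal {D₀ : ModularParametrizationData W N} {β : ℤ}
    [Fintype (ringClassGal ι 1)] (d : KolyvaginHeegnerData D₀ β ι 1) {A : Type*} [AddCommMonoid A]
    (f : (ringClassField K ι 1 ≃ₐ[ℚ] ringClassField K ι 1) → A) :
    ∑ s ∈ d.S, f s = ∑ σ : ringClassGal ι 1, f σ.1 := by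
  rw [← Finset.sum_subtype d.S (p := fun s ↦ s ∈ ringClassGal ι 1) (fun s ↦ d.mem_S_iff s) f]

/-- **The genus character's sign function.** For any predicate `p` on `𝒢₁` there is a `ℤˣ`-valued function
`s` with `(s σ : ℤ) = if p σ then 1 else −1` — the shape in which bsd-uniform U2's
`charHeegnerHeight_eq_of_sign` consumes a `±1`-valued character. [folklore] -/
theorem exists_units_sign {G : Type*} (p : G → Prop) :
    ∃ s : G → ℤˣ, ∀ σ, ((s σ : ℤˣ) : ℤ) = if p σ then (1 : ℤ) else -1 :=
  ⟨fun σ ↦ if p σ then 1 else -1, fun σ ↦ by by_cases h : p σ <;> simp [h]⟩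

end Reindex

end Summit.BirchSwinnertonDyer.BirchSwinnertonDyer.Theorems.GoldfeldGoodTwists

end
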